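import Literature.NumberTheory.EllipticCurves.FunctionFieldEllipticL
import Literature.NumberTheory.EllipticCurves.FunctionFieldUnramified
import Literature.NumberTheory.DiophantineGeometry.MinimalDiscriminantProofs
import HarnessLib

/-!
# Elliptic curves over global function fields — finiteness of the support of `ord_v(Δ_min)`

Discharge of the named fact
`Literature.NumberTheory.EllipticCurves.FunctionField.finite_setOf_ordMinimalDiscriminant_ne_zero`
(statement file `Literature.NumberTheory.EllipticCurves.FunctionFieldEllipticL`, section
`Discriminant`/`FunctionField`): for an elliptic curve `W` over a global function field `F / 𝔽_q(T)`,
only finitely many places `v` of `F` have `ord_v(Δ_min) ≠ 0`, so that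
`degMinimalDiscriminant q W = ∑ᶠ_v ord_v(Δ_min) · deg v` is a genuine finite sum.

Kept in its own sibling file, like `FunctionFieldEllipticLDegMinimalDiscriminantProofs` (the
discharge of `twelve_dvd_degMinimalDiscriminant`): the statement file cannot import the two proof
files used here (`FunctionFieldUnramified`, for `finite_badPlaces`, and
`DiophantineGeometry.MinimalDiscriminantProofs`, for `ordMinimalDiscriminant_eq_zero_iff_holds`),
both of which import it.

## Proof (Silverman, *AEC* VIII.1 Remark 1.3 with VII.5 Prop. 5.1(a))

At a place `v` of `F` with discrete valuation ring `O_v = v.1` and height-one prime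
`𝔪_v = v.spectrum`, `ord_v(Δ_min) = W.ordMinimalDiscriminant v.spectrum` vanishes iff `W` has good
reduction at `v` (Silverman VII.5 Prop. 5.1(a); the tree's
`WeierstrassCurve.ordMinimalDiscriminant_eq_zero_iff_holds`, over the Dedekind domain `O_v`). Hence
`{v | ord_v(Δ_min) ≠ 0}` is the set `badPlaces W` of places of bad reduction, which is finite for a
global function field (Silverman VIII.1 Remark 1.3: outside the finitely many poles of
`a₁, …, a₆, Δ, Δ⁻¹` the given equation is integral with unit discriminant, hence minimal with
nonsingular reduction; the tree's `finite_badPlaces`, from Stichtenoth Cor. I.3.4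
`Place.finite_setOf_ord_ne_zero`). As for the other `_holds` theorems of this family, the finite
constant field `𝔽_q` and the function-field structure `[FunctionField Fq F]`, which the body of the
`def` does not mention, are supplied as binders of the theorem (design note of
`FunctionFieldPlaces` / `FunctionFieldEllipticL`).

## References

* [SilvermanAEC2009] J. H. Silverman, *The Arithmetic of Elliptic Curves*, GTM 106, 2nd ed. 2009,
  §VII.5 Prop. 5.1(a) (good reduction iff a minimal equation has `v(Δ) = 0`), §VIII.1 Remark 1.3
  ("for all but finitely many `v ∈ M_K⁰` … the given equation is already a minimal Weierstrass
  equation and the reduced curve is nonsingular"), §VIII.8 (the minimal discriminant).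
* [Stichtenoth2009] H. Stichtenoth, *Algebraic Function Fields and Codes*, GTM 254, 2nd ed. 2009,
  Cor. I.3.4 (a nonzero element has finitely many zeros and poles).
* [Ulmer2011ParkCity] D. Ulmer, *Elliptic curves over function fields*, IAS/Park City Math. Ser. 18
  (2011), Lecture 1, §7 (local invariants) and Lecture 3, §2 (`deg Δ_min`).
-/

namespace Literature.NumberTheory.EllipticCurves.FunctionField

open scoped Polynomial

variable (Fq : Type) [Field Fq] [Fintype Fq] {F : Type} [Field F]
variable [Algebra Fq[X] F] [Algebra (RatFunc Fq) F] [IsScalarTower Fq[X] (RatFunc Fq) F]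
variable [FunctionField Fq F]
variable (W : WeierstrassCurve F)

include Fq in
/-- **Discharge** of `finite_setOf_ordMinimalDiscriminant_ne_zero`: for an elliptic curve `W` over a
global function field `F / 𝔽_q(T)`, the set of places `v` with `ord_v(Δ_min) ≠ 0` is finite — it is
contained in (indeed equal to) the finite set `badPlaces W` of places of bad reduction, since
`ord_v(Δ_min) = 0 ↔` good reduction at `v` (Silverman VII.5 Prop. 5.1(a),
`WeierstrassCurve.ordMinimalDiscriminant_eq_zero_iff_holds` over `O_v`) and an elliptic curve over a
global function field has finitely many bad places (Silverman VIII.1 Remark 1.3, `finite_badPlaces`).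
[cite: SilvermanAEC2009, VII.5 Prop. 5.1(a) and VIII.1 Remark 1.3] -/
theorem finite_setOf_ordMinimalDiscriminant_ne_zero_holds :
    finite_setOf_ordMinimalDiscriminant_ne_zero W := by
  intro hE
  refine (finite_badPlaces Fq W).subset fun v hv => ?_
  rw [mem_badPlaces_iff]
  exact fun hgood =>
    hv ((WeierstrassCurve.ordMinimalDiscriminant_eq_zero_iff_holds v.spectrum W).mpr hgood)

end Literature.NumberTheory.EllipticCurves.FunctionField
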